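import Literature.AlgebraicGeometry.Resolution.ResiduallyAlgebraicReduction
import Literature.AlgebraicGeometry.Resolution.DiscreteSeparableResidueLocalUniformization
import Literature.AlgebraicGeometry.Resolution.RationalDiscreteLocalUniformization
import HarnessLib

/-!
# The open core of the `μ_p`-torsor step: rank one, residually algebraic, not discrete with separable residue field

Topic: `Literature/AlgebraicGeometry/Resolution`. Assembly of three reductions of the tree:

* Novacoski–Spivakovsky 2014, Thm. 1.1 (rank one; tree theorem `NovacoskiSpivakovsky2014_holds`,
  `RankOneReductionProofs.lean`);
* enlarging the ground field inside the valuation ring until the residue field is algebraic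
  over it (`ResiduallyAlgebraicReduction.lean`, folklore: Zariski–Samuel II, Ch. VI §14);
* Knaf–Kuhlmann 2009, Thm. 1.5 for monogenic Abhyankar subfields (named fact
  `KnafKuhlmann2009MonogenicCompletion`, `DiscreteSeparableResidueLocalUniformization.lean`,
  where it is PROVED that every discrete valuation ring over `k` whose residue field is finite
  separable over `k` satisfies its hypotheses): such valuation rings — the arcs through
  separable points — admit relative local uniformization in every characteristic and dimension;

with the model-form `μ_p`-torsor criterion of `MuPTorsorLocalUniformizationRelative.lean`
(Temkin 2013 in height one + Cossart–Piltant 2019 in dimension `≤ 3` + Cutkosky 2022 at Abhyankar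
places). Result (`relLocalUniformization_iff_openCore_relCoreSteps`): granted the three published
theorems `Temkin2013HeightLeOne`, `CossartPiltant2019LU3`, `KnafKuhlmann2009MonogenicCompletion`,
relative local uniformization over all fields of characteristic `p` is EQUIVALENT to the core
model-form `μ_p`-torsor steps at the valuation rings `O ⊇ k` (of finitely generated `K/k`, `k` any
field of characteristic `p`) which are

  (1) of rank one, (2) residually algebraic over `k`, and (3) NOT discrete valuation rings with
  residue field finite separable over `k` (generated by the separable residue of one element).

The direction "relative LU ⇒ steps" is unconditional. `localUniformizationInChar_of_openCore_relCoreSteps`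
feeds the summit (`LocalUniformizationInChar p`).
-/

noncomputable section

namespace Literature.AlgebraicGeometry.Resolution

variable {p : ℕ}

/-- **Core steps on the open core ⇒ relative local uniformization everywhere** (characteristic
`p`, any ground field), granted Temkin (height one), Cossart–Piltant (dimension `≤ 3`) and
Knaf–Kuhlmann 2009 Thm. 1.5 (discrete places with finite separable residue field extension).
[cite: NovacoskiSpivakovsky2014, Thm. 1.1; KnafKuhlmann2009, Thm. 1.5; Temkin2013, Section 4.1; CossartPiltant2019, Thm. 1.1; Cutkosky2022, Thm. 1.3] -/
theorem relLocalUniformization_of_openCore_relCoreSteps [Fact p.Prime]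
    (hT₁ : Temkin2013HeightLeOne.{0}) (hCP : CossartPiltant2019LU3.{0})
    (hKK : KnafKuhlmann2009MonogenicCompletion)
    (H : ∀ (k K : Type) [Field k] [CharP k p] [Field K] [Algebra k K],
      (⊤ : IntermediateField k K).FG → ∀ O : ValuationSubring K,
        Nonempty O.valuation.RankOne → (∀ c : k, algebraMap k K c ∈ O) →
          IsResiduallyAlgebraic k O → ¬ IsDiscreteWithSeparableResidue k O →
            RelMuPTorsorCoreStepsAt p k O)
    (k K : Type) [Field k] [CharP k p] [Field K] [Algebra k K] (O : ValuationSubring K) :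
    RelLocalUniformization k K O := by
  classical
  refine NovacoskiSpivakovsky2014_holds k (fun K _ _ O hr => ?_) K O
  intro R hRfg hRfr hRO
  have hk : ∀ c : k, algebraMap k K c ∈ O := algebraMap_mem_of_le O R hRO
  have hfg : (⊤ : IntermediateField k K).FG := fg_top_of_model R hRfg hRfr
  refine relLocalUniformization_of_forall_isResiduallyAlgebraic hfg O hk (fun k₁ hk₁O hra => ?_)
    R hRfg hRfr hRO
  haveI : CharP k₁ p := charP_of_injective_algebraMap (algebraMap k k₁).injective p
  have hfg₁ : (⊤ : IntermediateField k₁ K).FG := intermediateField_fg_top_of_fg_top k₁ hfg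
  have hk₁ : ∀ c : k₁, algebraMap k₁ K c ∈ O := hk₁O
  by_cases hrd : IsDiscreteWithSeparableResidue k₁ O
  · exact relLocalUniformization_of_isDiscreteWithSeparableResidue hKK hfg₁ O hk₁ hrd
  · exact relLocalUniformization_of_relCoreStepsAt_of_rankOne hT₁ hCP O hr hk₁
      (H k₁ K hfg₁ O hr hk₁ hra hrd)

/-- **Relative local uniformization in characteristic `p` ⟺ the core model-form `μ_p`-torsor
steps on the open core** (rank one, residually algebraic, not discrete with finite separable
residue field extension), granted
Temkin (height one), Cossart–Piltant (dimension `≤ 3`) and Knaf–Kuhlmann 2009 Thm. 1.5; `⇒` is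
unconditional.
[cite: NovacoskiSpivakovsky2014, Thm. 1.1; KnafKuhlmann2009, Thm. 1.5; Temkin2013, Section 4.1; CossartPiltant2019, Thm. 1.1; Cutkosky2022, Thm. 1.3] -/
theorem relLocalUniformization_iff_openCore_relCoreSteps [Fact p.Prime]
    (hT₁ : Temkin2013HeightLeOne.{0}) (hCP : CossartPiltant2019LU3.{0})
    (hKK : KnafKuhlmann2009MonogenicCompletion) :
    (∀ (k K : Type) [Field k] [CharP k p] [Field K] [Algebra k K] (O : ValuationSubring K),
        (∀ c : k, algebraMap k K c ∈ O) → RelLocalUniformization k K O) ↔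
      ∀ (k K : Type) [Field k] [CharP k p] [Field K] [Algebra k K],
        (⊤ : IntermediateField k K).FG → ∀ O : ValuationSubring K,
          Nonempty O.valuation.RankOne → (∀ c : k, algebraMap k K c ∈ O) →
            IsResiduallyAlgebraic k O → ¬ IsDiscreteWithSeparableResidue k O →
              RelMuPTorsorCoreStepsAt p k O := by
  constructor
  · intro h k K _ _ _ _ _ O _ hk _ _
    refine relCoreStepsAt_of_relLocalUniformization O hk fun K' => h k K' _ fun c => ?_
    rw [ValuationSubring.mem_comap, ← IsScalarTower.algebraMap_apply]
    exact hk c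
  · intro h k K _ _ _ _ O _
    exact relLocalUniformization_of_openCore_relCoreSteps hT₁ hCP hKK
      (fun k K _ _ _ _ hfg O hr hk hra hrd => h k K hfg O hr hk hra hrd) k K O

/-- **Local uniformization in characteristic `p` from the core steps on the open core.**
[cite: NovacoskiSpivakovsky2014, Thm. 1.1; KnafKuhlmann2009, Thm. 1.5; Temkin2013, Section 4.1; CossartPiltant2019, Thm. 1.1; Cutkosky2022, Thm. 1.3] -/
theorem localUniformizationInChar_of_openCore_relCoreSteps [Fact p.Prime]
    (hT₁ : Temkin2013HeightLeOne.{0}) (hCP : CossartPiltant2019LU3.{0})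
    (hKK : KnafKuhlmann2009MonogenicCompletion)
    (H : ∀ (k K : Type) [Field k] [CharP k p] [Field K] [Algebra k K],
      (⊤ : IntermediateField k K).FG → ∀ O : ValuationSubring K,
        Nonempty O.valuation.RankOne → (∀ c : k, algebraMap k K c ∈ O) →
          IsResiduallyAlgebraic k O → ¬ IsDiscreteWithSeparableResidue k O →
            RelMuPTorsorCoreStepsAt p k O) :
    LocalUniformizationInChar.{0} p := fun k K _ _ _ _ hfg O hk =>
  isLocallyUniformizable_of_relLocalUniformization hfg O hk
    (relLocalUniformization_of_openCore_relCoreSteps hT₁ hCP hKK H k K O)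

/-- The rational discrete fact of `RationalDiscreteLocalUniformization.lean` is a case of the
monogenic-completion fact: a discrete valuation ring with residue field `k` is discrete with
(finite) separable residue field extension (generator a uniformizer, separable polynomial `X`).
[cite: KnafKuhlmann2009, Thm. 1.5] [cite: Kuhlmann1999, Rem. 1 after Thm. 1.12] -/
theorem knafKuhlmann2009RationalDiscrete_of_monogenicCompletion
    (h : KnafKuhlmann2009MonogenicCompletion) : KnafKuhlmann2009RationalDiscrete :=
  fun _ _ _ _ _ hfg O hk hO hrat =>
    relLocalUniformization_of_isDiscreteWithSeparableResidue h hfg O hk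
      (isDiscreteWithSeparableResidue_of_rational O hO fun t ht => hrat t ht)

/-- A rational valuation ring is residually algebraic, and a rational discrete valuation ring is
discrete with separable residue field extension: condition (3) of the open core refines
condition (2) and contains the `k`-rational arcs. [folklore] -/
theorem IsRationalOver.isResiduallyAlgebraic_and {k K : Type} [Field k] [Field K] [Algebra k K]
    {O : ValuationSubring K} (h : IsRationalOver k O) :
    IsResiduallyAlgebraic k O ∧
      (IsDiscreteValuationRing O → IsDiscreteWithSeparableResidue k O) := by
  refine ⟨fun t ht => ?_, fun hO => isDiscreteWithSeparableResidue_of_rational O hO fun t ht => h t ht⟩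
  obtain ⟨c, hc⟩ := h t ht
  refine ⟨Polynomial.X - Polynomial.C c, Polynomial.X_sub_C_ne_zero c, ?_⟩
  simpa [Polynomial.aeval_X, Polynomial.aeval_C] using hc

end Literature.AlgebraicGeometry.Resolution

end
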